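import Summits.CriticalPhenomena.PercolationContinuityZ3.Theorems.Transplant.SkelPhiEquilibriumWDefs
import Summits.CriticalPhenomena.PercolationContinuityZ3.Theorems.Transplant.KNLevelsStepIV
import Summits.CriticalPhenomena.PercolationContinuityZ3.Theorems.Transplant.UniqZoneGeneric
import HarnessLib

/-!
# N1 (the {±1} node), LEVEL 0, file (L0-4, statement part): the STEP-I″ RECORD `StepI.DataN` and its input family `StepI.eventN` — zones `(t, M, none)` and
# the eight piece-links `(t, M, some (n, fam, σ, τ))` of the equilibrium parallelogram at zone size `M` and width `n` (pieces fattened at the link-region scale),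
# with finite edge supports (`edgesN`, `determinedBy_eventN`), the finite index set `indexN`, and the geometric clause `DataN.EqGeom`

This is the object LEVEL 1 consumes (NEG-SCOPE §3 (L0-4), V112 owners: run records p1, regions/(R) p2, kit adapter/(F) hp-8, (C) p5, params stmt): the data are the zone
family `Λ`, the seed level `k` (seed `Λ t k`), the prism radius `R`, the thresholds `M₀`, `n₁ : ℕ → ℕ` (zone size ↦ width threshold — "option 1"), and the equilibrium
functions `hgt/len/spl : V → ℕ → ℕ → _` (`(t, M, n) ↦ (h, ℓ, v)`; NO relation between different `n` is offered — K1-a).  The existence theorem with all events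
likely at `p` is (L0-4b) `SkelPhiStepINeg`.
builds on p205010 (kernel theorem, internal audit signed; external expert review pending) — nothing here uses p205010; nothing is claimed about the open node
`SamePDropOfSkeletonNeg`.  Lane `prim-bschramm`, seat `prim-bschramm-p3` (gen 8; design owner); helper file (`--supports stmt-CriticalPhenomena-4575`).
[cite: MartineauTassion2017, §3.2 Lemma 3.5, §3.3 Lemma 3.7 (𝒵(a,b,u,v), B(N))] [cite: KozmaNitzan2024, §4 Lemma 7 (p. 15), p. 16 (inputs are events of finite boxes)]
-/

noncomputable section

namespace Summit.CriticalPhenomena.PercolationContinuityZ3.Theorems.Transplant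

namespace Skelφ

namespace StepI

open MeasureTheory Literature.Probability.Percolation Literature.Probability.LatticeModels SimpleGraph KNLevels
open scoped Classical

variable {V : Type} (G : SimpleGraph V) (φ : V → Site 2)

/-- The index type of the N1 input family: base vertex × zone size × (`none` = zone | `some (n, fam, σ, τ)` = piece-link at width `n`, `fam = 0` side half /
`fam = 1` top-bottom piece, side sign `σ`, half sign `τ`). [this work] -/
abbrev IdxN (V : Type) := V × ℕ × Option (ℕ × Fin 2 × ℤˣ × ℤˣ)

/-- **Step-I″ data** of the {±1} node: zone family, seed level, prism radius, thresholds, and the equilibrium functions `(t, M, n) ↦ (h, ℓ, v)`. [this work] -/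
structure DataN (V : Type) where
  /-- the zone family at a base vertex (nested, exhausting) -/
  Λ : V → ℕ → Finset V
  /-- the seed level: the seed at `t` is `Λ t k` -/
  k : ℕ
  /-- the prism (kit) radius at planar scale `L` -/
  R : ℕ → ℕ
  /-- the zone-size threshold -/
  M₀ : ℕ
  /-- the width threshold at zone size `M` -/
  n₁ : ℕ → ℕ
  /-- the shear `h(t, M, n)` of the equilibrium parallelogram -/
  hgt : V → ℕ → ℕ → ℤ
  /-- the half-length `ℓ(t, M, n)` -/
  len : V → ℕ → ℕ → ℕ
  /-- the split point `v(t, M, n)` of the top/bottom layers -/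
  spl : V → ℕ → ℕ → ℤ

variable {G φ} in
/-- The link-region scale `L = pgScale n h (3ℓ)` of the equilibrium at `(t, M, n)`. [cite: MartineauTassion2017, §3.1 (R(a,b))] -/
def DataN.scale (D : DataN V) (t : V) (M n : ℕ) : ℕ := pgScale n (D.hgt t M n) (3 * D.len t M n)

/-- The piece `(fam, σ, τ)` of the equilibrium at `(t, M, n)` (a finset inside the link region). [cite: MartineauTassion2017, §3.2 (𝒵(a,b,u,v))] -/
def pieceN [G.LocallyFinite] (D : DataN V) (t : V) (M n : ℕ) (fam : Fin 2) (σ τ : ℤˣ) : Finset V :=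
  if fam = 0 then pgSideHalfW G φ t n (D.hgt t M n) (D.len t M n) (D.R (D.scale t M n)) (σ : ℤ) (τ : ℤ)
  else pgTopPieceW G φ t n (D.hgt t M n) (D.len t M n) (D.R (D.scale t M n)) (σ : ℤ) (τ : ℤ) (D.spl t M n)

/-- The link region of the equilibrium at `(t, M, n)`: the fat parallelogram `C(n,h,3ℓ) ∩ cylBall t L (R L)`. [cite: MartineauTassion2017, §3.1 (R(a,b))] -/
def regionN (D : DataN V) (t : V) (M n : ℕ) : Set V := pgramPrism G φ t n (D.hgt t M n) (3 * D.len t M n) (D.R (D.scale t M n))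

/-- **The input events of the {±1} node**: the uniqueness zone (`none`) and the piece-links of the equilibrium (`some`). [cite: MartineauTassion2017, §3.3 Lemma 3.7] -/
def eventN [G.LocallyFinite] (D : DataN V) : IdxN V → Set (BondConfig V)
  | (t, M, none) => UniqZone.zone G (D.Λ t) D.k M
  | (t, M, some (n, fam, σ, τ)) => linkIn (regionN G φ D t M n) (D.Λ t D.k) (pieceN G φ D t M n fam σ τ)

/-- **The finite edge support** of an input event. [folklore] -/
def edgesN [G.LocallyFinite] (D : DataN V) : IdxN V → Finset (Sym2 V)
  | (t, M, none) => pairsF (D.Λ t M)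
  | (t, M, some (n, _, _, _)) => pairsF (pgramPrismFin G φ t n (D.hgt t M n) (3 * D.len t M n) (D.R (D.scale t M n)))

/-- The zone input, unfolded. [folklore] -/
@[simp] theorem eventN_none [G.LocallyFinite] (D : DataN V) (t : V) (M : ℕ) : eventN G φ D (t, M, none) = UniqZone.zone G (D.Λ t) D.k M := rfl

/-- The piece-link input, unfolded. [folklore] -/
@[simp] theorem eventN_some [G.LocallyFinite] (D : DataN V) (t : V) (M n : ℕ) (fam : Fin 2) (σ τ : ℤˣ) :
    eventN G φ D (t, M, some (n, fam, σ, τ)) = linkIn (regionN G φ D t M n) (D.Λ t D.k) (pieceN G φ D t M n fam σ τ) := rfl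

/-- The coercion of `pgramPrismFin`. [folklore] -/
theorem coe_pgramPrismFin [G.LocallyFinite] (t : V) (n : ℕ) (h : ℤ) (ℓ R : ℕ) :
    (↑(pgramPrismFin G φ t n h ℓ R) : Set V) = pgramPrism G φ t n h ℓ R := by
  ext w; rw [Finset.mem_coe, mem_pgramPrismFin]

/-- **Every input event is determined by the pairs of its support.** [cite: KozmaNitzan2024, §4 p. 16] -/
theorem determinedBy_eventN [G.LocallyFinite] (D : DataN V) (i : IdxN V) : DeterminedBy (eventN G φ D i) (↑(edgesN G φ D i) : Set (Sym2 V)) := by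
  obtain ⟨t, M, og⟩ := i
  rcases og with _ | ⟨n, fam, σ, τ⟩
  · exact determinedBy_zone _ _ _ (by rw [edgesN, coe_pairsF])
  · refine determinedBy_linkIn _ _ _ ?_
    rw [edgesN, coe_pairsF, coe_pgramPrismFin, regionN]

/-- Input events are measurable. [folklore] -/
theorem measurableSet_eventN [G.LocallyFinite] (D : DataN V) (i : IdxN V) : MeasurableSet (eventN G φ D i) :=
  (determinedBy_eventN G φ D i).measurableSet_of_finset

/-- The pieces lie in the link region. [folklore] -/
theorem coe_pieceN_subset [G.LocallyFinite] (D : DataN V) (t : V) (M n : ℕ) (fam : Fin 2) (σ τ : ℤˣ) :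
    (↑(pieceN G φ D t M n fam σ τ) : Set V) ⊆ regionN G φ D t M n := by
  unfold pieceN regionN
  split_ifs
  · exact coe_pgSideHalfW_subset t n _ _ _ _ _
  · exact coe_pgTopPieceW_subset t n _ _ _ _ _ _

variable {G φ}

/-- **The geometric clause of the equilibrium at `(t, M, n)`**: the zone is strictly inside (`M < n`, `M < ℓ`), the split is on the top (`|v| ≤ n`), the zone-clearance
inequality `(M+1)(n+|h|) ≤ n(ℓ+1)`, and all eight pieces miss the zone box `cyl t M`. [cite: MartineauTassion2017, §3.2 Lemma 3.5 (B ∩ Z = ∅)] -/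
def DataN.EqGeom (D : DataN V) (G : SimpleGraph V) [G.LocallyFinite] (φ : V → Site 2) (t : V) (M n : ℕ) : Prop :=
  M < n ∧ M < D.len t M n ∧ |D.spl t M n| ≤ n ∧ (M + 1 : ℤ) * (n + (D.hgt t M n).natAbs : ℕ) ≤ (n : ℤ) * (D.len t M n + 1 : ℕ) ∧
    ∀ (fam : Fin 2) (σ τ : ℤˣ), Disjoint (↑(pieceN G φ D t M n fam σ τ) : Set V) (cyl φ t M)

/-- **`EquilibriumAtW` at the recorded data gives the geometric clause and the eight likely piece-links.** [folklore] -/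
theorem DataN.eqGeom_and_links [G.LocallyFinite] {p : unitInterval} {D : DataN V} {t : V} {M n : ℕ} {ε : ℝ}
    (hE : M < n ∧ M < D.len t M n ∧ |D.spl t M n| ≤ n ∧ (M + 1 : ℤ) * (n + (D.hgt t M n).natAbs : ℕ) ≤ (n : ℤ) * (D.len t M n + 1 : ℕ) ∧
      ∀ σ τ : ℤ, (σ = 1 ∨ σ = -1) → (τ = 1 ∨ τ = -1) →
        Disjoint (↑(pgSideHalfW G φ t n (D.hgt t M n) (D.len t M n) (D.R (D.scale t M n)) σ τ) : Set V) (cyl φ t M) ∧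
        Disjoint (↑(pgTopPieceW G φ t n (D.hgt t M n) (D.len t M n) (D.R (D.scale t M n)) σ τ (D.spl t M n)) : Set V) (cyl φ t M) ∧
        1 - ε ≤ (bondPercolation G p).real (linkIn (regionN G φ D t M n) (D.Λ t D.k)
          (pgSideHalfW G φ t n (D.hgt t M n) (D.len t M n) (D.R (D.scale t M n)) σ τ)) ∧
        1 - ε ≤ (bondPercolation G p).real (linkIn (regionN G φ D t M n) (D.Λ t D.k)
          (pgTopPieceW G φ t n (D.hgt t M n) (D.len t M n) (D.R (D.scale t M n)) σ τ (D.spl t M n)))) :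
    D.EqGeom G φ t M n ∧ ∀ (fam : Fin 2) (σ τ : ℤˣ), 1 - ε ≤ (bondPercolation G p).real (eventN G φ D (t, M, some (n, fam, σ, τ))) := by
  obtain ⟨h1, h2, h3, h4, h5⟩ := hE
  have hu : ∀ σ : ℤˣ, ((σ : ℤ) = 1 ∨ (σ : ℤ) = -1) := fun σ => by rcases Int.units_eq_one_or σ with h | h <;> simp [h]
  refine ⟨⟨h1, h2, h3, h4, fun fam σ τ => ?_⟩, fun fam σ τ => ?_⟩
  · unfold pieceN; split_ifs
    · exact (h5 σ τ (hu σ) (hu τ)).1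
    · exact (h5 σ τ (hu σ) (hu τ)).2.1
  · rw [eventN_some]; unfold pieceN; split_ifs
    · exact (h5 σ τ (hu σ) (hu τ)).2.2.1
    · exact (h5 σ τ (hu σ) (hu τ)).2.2.2

/-! ## The finite index set -/

/-- **The finite index set** of the N1 inputs: base vertices × zone sizes `Sz` × (`none` | widths `Sn` × families × signs). [folklore] -/
def indexN (types : Finset V) (Sz Sn : Finset ℕ) : Finset (IdxN V) :=
  types ×ˢ ((Sz ×ˢ ({none} : Finset (Option (ℕ × Fin 2 × ℤˣ × ℤˣ)))) ∪
    (Sz ×ˢ ((Sn ×ˢ (Finset.univ : Finset (Fin 2 × ℤˣ × ℤˣ))).image fun q => some (q.1, q.2))))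

/-- Zone indices belong to the index set. [folklore] -/
theorem mem_indexN_none {types : Finset V} {Sz Sn : Finset ℕ} {t : V} (ht : t ∈ types) {M : ℕ} (hM : M ∈ Sz) : (t, M, none) ∈ indexN types Sz Sn := by
  rw [indexN, Finset.mem_product]
  exact ⟨ht, Finset.mem_union_left _ (Finset.mem_product.2 ⟨hM, Finset.mem_singleton_self _⟩)⟩

/-- Piece-link indices belong to the index set. [folklore] -/
theorem mem_indexN_some {types : Finset V} {Sz Sn : Finset ℕ} {t : V} (ht : t ∈ types) {M : ℕ} (hM : M ∈ Sz) {n : ℕ} (hn : n ∈ Sn) (fam : Fin 2)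
    (σ τ : ℤˣ) : (t, M, some (n, fam, σ, τ)) ∈ indexN types Sz Sn := by
  rw [indexN, Finset.mem_product]
  refine ⟨ht, Finset.mem_union_right _ (Finset.mem_product.2 ⟨hM, ?_⟩)⟩
  rw [Finset.mem_image]
  exact ⟨(n, fam, σ, τ), Finset.mem_product.2 ⟨hn, Finset.mem_univ _⟩, rfl⟩

/-- The shape of an index in the index set. [folklore] -/
theorem of_mem_indexN {types : Finset V} {Sz Sn : Finset ℕ} {i : IdxN V} (hi : i ∈ indexN types Sz Sn) :
    i.1 ∈ types ∧ i.2.1 ∈ Sz ∧ (i.2.2 = none ∨ ∃ n ∈ Sn, ∃ (fam : Fin 2) (σ τ : ℤˣ), i.2.2 = some (n, fam, σ, τ)) := by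
  obtain ⟨t, M, og⟩ := i
  rw [indexN, Finset.mem_product, Finset.mem_union, Finset.mem_product, Finset.mem_product, Finset.mem_singleton, Finset.mem_image] at hi
  obtain ⟨ht, h | ⟨hM, q, hq, hqe⟩⟩ := hi
  · exact ⟨ht, h.1, Or.inl h.2⟩
  · refine ⟨ht, hM, Or.inr ⟨q.1, (Finset.mem_product.1 hq).1, q.2.1, q.2.2.1, q.2.2.2, ?_⟩⟩
    rw [← hqe]

end StepI

end Skelφ

end Summit.CriticalPhenomena.PercolationContinuityZ3.Theorems.Transplant

end
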